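import Mathlib
import Summits.Ventures.HodgeRepro.Tier4.Line1.RTFSetting
import Summits.Ventures.HodgeRepro.Tier4.Line1.GeneratedSubspace
import Summits.Ventures.HodgeRepro.Tier4.Line1.IsotypicIdempotent
import Summits.Ventures.HodgeRepro.Tier4.Line1.IsotypicSchur
import Summits.Ventures.HodgeRepro.Tier4.Line1.IsotypicBlock
import Summits.Ventures.HodgeRepro.Tier4.Line1.ConvAssoc

/-!
# Tier4/Line1/IsotypicStable — the type-σ block is STABLE under `R(eσ) ∘ R(f)`: the instance side (`hcont`, `hfix`,
`hstab`) of the Hecke algebra of a block (plan-1's cut (α) S14266 for this seat; consumer = t4-L1-p2's (C-HECKE-ALG)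
`HeckeAlgebraInstance` S14262 on `e := eσ`, `Vb := isotypicFixed`)

Blind re-derivation cell `pub-hodge-repro`, Tier 4 (README §9–§10), seat t4-L1-p3 (prover, LINE L1, gen 3).  Target tree
path `lean/Summits/Ventures/HodgeRepro/Tier4/Line1/IsotypicStable.lean`.  Imports this seat's `IsotypicBlock` (p690873:
`isotypicFixed`, `mem_isotypicFixed`), `IsotypicSchur` (p690696: `conv_eσ_eσ`), `ConvAssoc` (p691474: `conv_assoc`),
`IsotypicIdempotent` (p690327: `isTest_eσ`); t4-L1-p2's `GeneratedSubspace` (p687702: `R_R_eq_R_conv`) and through it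
t4-L1-p4's `RelClosed` (`R_invariant`, `continuous_R_of_invariant`).  0 printed inputs.

CONTENT (on `Vb := isotypicFixed S K ρ hKo hKc hρ`): `hcont_isotypicFixed : ∀ ψ ∈ Vb, Continuous ψ` and
`hfix_isotypicFixed : ∀ ψ ∈ Vb, R(eσ) ψ = ψ` (the conjuncts of `mem_isotypicFixed`); **`hstab_isotypicFixed (hirr) :
∀ f, IsTest f → ∀ ψ ∈ Vb, R(eσ)(R(f) ψ) ∈ Vb`** (invariance and continuity of `R(g) ψ` by `R_invariant` /
`continuous_R_of_invariant`; `R(eσ)(R(eσ)(R(f)ψ)) = R(eσ ⋆ eσ)(R(f)ψ) = R(eσ)(R(f)ψ)` by `R_R_eq_R_conv` + `conv_eσ_eσ`);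
the left twin `R_conv_eσ_left_mem : R(eσ ⋆ f) ψ ∈ Vb` for every continuous invariant `ψ`, the two-sided
`R_conv_conv_eσ_mem : R(eσ ⋆ f ⋆ eσ) ψ ∈ Vb` for `ψ ∈ Vb`, and the right normalisation `R_conv_eσ_right_eq :
R(f ⋆ eσ) ψ = R(f) ψ` on `Vb` — NOTE: `R(f ⋆ eσ) ψ` is NOT in `Vb` in general (the block's fixedness is the LEFT condition
`R(eσ)(R(t)ψ) = R(eσ ⋆ t)ψ`), which is why the instance side hands p2's `blockOp` the `R(e)(R(f)ψ)` form.
NOT claimed: the Hecke algebra itself (p2's cut), (C1), (C2), the instance's corner forms, or `P_T4`.  Nothing here says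
anything about the status of the Hodge conjecture for CM abelian varieties, which is NOT proved (HC_CM is NOT proved by
anyone in this repository).
-/

set_option autoImplicit false

noncomputable section

namespace Summit.Ventures.HodgeRepro.Tier4.Line1

open MeasureTheory Topology Set

namespace RTF.Setting

variable {G : Type} [Group G] [TopologicalSpace G] [IsTopologicalGroup G] [MeasurableSpace G] [BorelSpace G]
  (S : Setting G) (K : Subgroup G) {d : ℕ} (ρ : K →* Matrix (Fin d) (Fin d) ℂ)
  (hKo : IsOpen (K : Set G)) (hKc : IsCompact (K : Set G)) (hρ : Continuous ρ)

/-- `hcont`: every element of the type-σ block is continuous. -/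
theorem hcont_isotypicFixed : ∀ ψ ∈ isotypicFixed S K ρ hKo hKc hρ, Continuous ψ := fun _ hψ => hψ.2.1

/-- `hfix`: `R(eσ)` is the identity on the type-σ block. -/
theorem hfix_isotypicFixed : ∀ ψ ∈ isotypicFixed S K ρ hKo hKc hρ, S.R (eσ S K ρ) ψ = ψ := fun _ hψ => hψ.2.2

/-- every element of the type-σ block is `Gk`-invariant. -/
theorem hinv_isotypicFixed : ∀ ψ ∈ isotypicFixed S K ρ hKo hKc hρ, S.Invariant ψ := fun _ hψ => hψ.1

variable [SecondCountableTopology G] [T2Space G] [MeasurableMul G] [SFinite S.μ]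

include hKo hKc hρ in
/-- **`R(eσ ⋆ f) ψ` lies in the type-σ block** for every test function `f` and every continuous invariant `ψ`
(`R(eσ)(R(eσ ⋆ f)ψ) = R(eσ ⋆ (eσ ⋆ f))ψ = R(eσ ⋆ f)ψ`). -/
theorem R_conv_eσ_left_mem (hirr : IsIrreducibleRep ρ) {f : G → ℂ} (hf : IsTest f) {ψ : G → ℂ}
    (hψ : S.Invariant ψ) (hψc : Continuous ψ) :
    S.R (S.conv (eσ S K ρ) f) ψ ∈ isotypicFixed S K ρ hKo hKc hρ := by
  have he := isTest_eσ S K ρ hKo hKc hρ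
  have ht : IsTest (S.conv (eσ S K ρ) f) := (S.conv_isTest he hf).1
  refine ⟨S.R_invariant _ hψ, S.continuous_R_of_invariant ht hψ hψc, ?_⟩
  rw [S.R_R_eq_R_conv he ht hψc, ← S.conv_assoc he he hf, conv_eσ_eσ S K ρ hKo hKc hρ hirr]

include hKo hKc hρ in
/-- **`hstab`: the type-σ block is stable under `R(eσ) ∘ R(f)`** for every test function `f` (p2's `blockOp` binder). -/
theorem hstab_isotypicFixed (hirr : IsIrreducibleRep ρ) :
    ∀ f, IsTest f → ∀ ψ ∈ isotypicFixed S K ρ hKo hKc hρ,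
      S.R (eσ S K ρ) (S.R f ψ) ∈ isotypicFixed S K ρ hKo hKc hρ := by
  intro f hf ψ hψ
  rw [S.R_R_eq_R_conv (isTest_eσ S K ρ hKo hKc hρ) hf hψ.2.1]
  exact S.R_conv_eσ_left_mem K ρ hKo hKc hρ hirr hf hψ.1 hψ.2.1

include hKo hKc hρ in
/-- the right normalisation on the block: `R(f ⋆ eσ) ψ = R(f) ψ` for `ψ ∈ Vb` (`R(f ⋆ eσ)ψ = R(f)(R(eσ)ψ)`). -/
theorem R_conv_eσ_right_eq {f : G → ℂ} (hf : IsTest f) {ψ : G → ℂ} (hψ : ψ ∈ isotypicFixed S K ρ hKo hKc hρ) :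
    S.R (S.conv f (eσ S K ρ)) ψ = S.R f ψ := by
  rw [← S.R_R_eq_R_conv hf (isTest_eσ S K ρ hKo hKc hρ) hψ.2.1, hψ.2.2]

include hKo hKc hρ in
/-- **the two-sided Hecke elements act on the block**: `R(eσ ⋆ f ⋆ eσ) ψ ∈ Vb` for `ψ ∈ Vb` (and it equals
`R(eσ)(R(f)ψ)`). -/
theorem R_conv_conv_eσ_mem (hirr : IsIrreducibleRep ρ) {f : G → ℂ} (hf : IsTest f) {ψ : G → ℂ}
    (hψ : ψ ∈ isotypicFixed S K ρ hKo hKc hρ) :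
    S.R (S.conv (S.conv (eσ S K ρ) f) (eσ S K ρ)) ψ ∈ isotypicFixed S K ρ hKo hKc hρ := by
  rw [S.R_conv_eσ_right_eq K ρ hKo hKc hρ (S.conv_isTest (isTest_eσ S K ρ hKo hKc hρ) hf).1 hψ]
  exact S.R_conv_eσ_left_mem K ρ hKo hKc hρ hirr hf hψ.1 hψ.2.1

end RTF.Setting

end Summit.Ventures.HodgeRepro.Tier4.Line1
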